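import Summits.AtomisticToContinuum.Crystallization.Theorems.OverbindingBudgetAffineFarFieldCellFacetsTRD

/-!
# Overbinding budget — far-field Voronoi cells, part 27V-T «CellFacetsHCP»: the twelve facet prisms of the `h`-cell

Route `OverbindingBudget`, crux `RobustDefectLimitWindows` (stmt-31280), line (2c), leaf SW♭(30),
part 27V-T, item T4 (★ r1738 (B)/(τ) shape of record).  Assembles «CellFacetsTRD»: for `0 < h`,
`w ∈ hcpInt` (bond `v = (2h/3)·w`, `‖v‖² = 8h²`) and `ε < 1/3`, the cap
`trdCell h ∩ {x | 4h²(1 - ε) ≤ ⟪x, v⟫}` lies in a facet prism `p + T '' ([-ε/2, 1 + ε/2]² × [-ε, 0])`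
with `T` onto, lower row `√2·h`, and `|det T| = 16h³/3` on the six equatorial bonds (`Σw = 0`,
trapezoids in their edge parallelograms) resp. `4h³` on the six polar bonds (rhombi) —
`trdCell_cap_subset_prism`; summed over the twelve bonds `Σ|det T| = 56h³ = (7/6)·48h³`
(the `k`-cell has `12·4h³ = 48h³`, «CellFacets»).
§1 three transported base statements (equatorial / upper / lower class) from a symmetry `g` of
`trdCell h` carrying the class representative to `w`; §2 the coordinate permutations `cycIso`,
`swapIso` (symmetries of `trdCell h`, parts 27Vb-K(B1/B2)) act on `hcpInt` with the three orbits
`{Σw = 0}`, `{Σw = 6}`, `{Σw = -6}`; §3 the FACET HALF-SPACES `⟪x, u⟫ ≤ ‖u‖²/2 = 4h²` for every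
own bond `u` of either ideal cell (hypothesis `hK'` of «CollarKit» `inter_subset_image_cap`, after
the orientation bookkeeping of 27Vc) and `‖u‖² = 8h²`.  Pure analysis on `ℝ³`, atlas-free.
-/

namespace Summit.AtomisticToContinuum.Crystallization.Theorems.OverbindingBudgetAffineFarFieldCellFacetsHCP

noncomputable section

open Set MeasureTheory Metric
open scoped Pointwise
open Literature.Geometry.DiscreteGeometry (intVec intVec_apply fccInt hcpInt)
open Summit.AtomisticToContinuum.Crystallization.Theorems.OverbindingBudgetAffineFarFieldCellRD
open Summit.AtomisticToContinuum.Crystallization.Theorems.OverbindingBudgetAffineFarFieldCellSymm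
open Summit.AtomisticToContinuum.Crystallization.Theorems.OverbindingBudgetAffineFarFieldCellTwist
open Summit.AtomisticToContinuum.Crystallization.Theorems.OverbindingBudgetAffineFarFieldCellTRD
open Summit.AtomisticToContinuum.Crystallization.Theorems.OverbindingBudgetAffineFarFieldCellTRDCubic
open Summit.AtomisticToContinuum.Crystallization.Theorems.OverbindingBudgetAffineFarFieldCellFacets
open Summit.AtomisticToContinuum.Crystallization.Theorems.OverbindingBudgetAffineFarFieldCellFacetsTRD

local notation "E3" => EuclideanSpace ℝ (Fin 3)

/-! ## §1 Transport of the three base statements -/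

/-- TRANSPORT of a cap-in-prism package (`|det|`, lower row `√2·h`, containment) along a symmetry `g`
of `K`: the frame is composed with `g`, which keeps `|det|` and the lower row, hence onto. -/
theorem prism_transport {h d β : ℝ} (hh : 0 < h) {K B : Set E3} {v : E3} (g : E3 ≃ₗᵢ[ℝ] E3)
    (hg : ∀ x ∈ K, g.symm x ∈ K)
    (base : ∃ (p : E3) (T : E3 →L[ℝ] E3), |T.det| = d ∧ (∀ x, Real.sqrt 2 * h * ‖x‖ ≤ ‖T x‖) ∧
      K ∩ {x | β ≤ inner ℝ x v} ⊆ (fun x => p + T x) '' B) :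
    ∃ (p : E3) (T : E3 →L[ℝ] E3), |T.det| = d ∧ (∀ x, Real.sqrt 2 * h * ‖x‖ ≤ ‖T x‖) ∧
      Function.Surjective T ∧ K ∩ {x | β ≤ inner ℝ x (g v)} ⊆ (fun x => p + T x) '' B := by
  obtain ⟨p, T, hdet, hlowT, hsub⟩ := base
  have hG : ∀ u, ‖g.toLinearIsometry.toContinuousLinearMap u‖ = ‖u‖ := fun u => g.norm_map u
  have hlow := lower_row_comp_of_norm_eq _ T hG hlowT
  refine ⟨g p, g.toLinearIsometry.toContinuousLinearMap.comp T, ?_, hlow,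
    surjective_of_lower_row _ (by positivity) hlow, cap_subset_prism_transport g hg hsub⟩
  rw [abs_det_comp_of_norm_eq_left _ _ hG, hdet]

/-- EQUATORIAL CLASS: a symmetry of `trdCell h` carrying `(3,-3,0)` to `w` yields the facet prism of
the bond `(2h/3)·w` with `|det T| = 16h³/3`, for every `ε`. -/
theorem prism_eq_class {h : ℝ} (hh : 0 < h) (ε : ℝ) {w : Fin 3 → ℤ} (g : E3 ≃ₗᵢ[ℝ] E3)
    (hg : IsInvariantUnder (trdCell h) 0 g.symm) (hgv : g (intVec ![3, -3, 0]) = intVec w) :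
    ∃ (p : E3) (T : E3 →L[ℝ] E3), |T.det| = 16 / 3 * h ^ 3 ∧
      (∀ x, Real.sqrt 2 * h * ‖x‖ ≤ ‖T x‖) ∧ Function.Surjective T ∧
      trdCell h ∩ {x | 4 * h ^ 2 * (1 - ε) ≤ inner ℝ x ((2 * h / 3) • intVec w)} ⊆
        (fun x => p + T x) ''
          {x : E3 | ∀ i, ![-(ε / 2), -(ε / 2), -ε] i ≤ x i ∧ x i ≤ ![1 + ε / 2, 1 + ε / 2, 0] i} := by
  have hv : g ((2 * h / 3) • intVec ![3, -3, 0]) = (2 * h / 3) • intVec w := by rw [map_smul, hgv]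
  rw [← hv]
  exact prism_transport hh g (fun x hx => mem_of_isInvariantUnder hg hx)
    ⟨_, _, abs_det_eqFrame h hh.le, lower_row_eqFrame h hh.le, trdCell_eqCap_subset_prism hh ε⟩

/-- UPPER CLASS: a symmetry of `trdCell h` carrying `(3,3,0)` to `w` yields, for `ε < 1/3`, the facet
prism of the bond `(2h/3)·w` with `|det T| = 4h³` (the `k`-cell's prism at `2h(1,1,0)`, transported). -/
theorem prism_up_class {h ε : ℝ} (hh : 0 < h) (hε : ε < 1 / 3) {w : Fin 3 → ℤ} (g : E3 ≃ₗᵢ[ℝ] E3)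
    (hg : IsInvariantUnder (trdCell h) 0 g.symm) (hgv : g (intVec ![3, 3, 0]) = intVec w) :
    ∃ (p : E3) (T : E3 →L[ℝ] E3), |T.det| = 4 * h ^ 3 ∧
      (∀ x, Real.sqrt 2 * h * ‖x‖ ≤ ‖T x‖) ∧ Function.Surjective T ∧
      trdCell h ∩ {x | 4 * h ^ 2 * (1 - ε) ≤ inner ℝ x ((2 * h / 3) • intVec w)} ⊆
        (fun x => p + T x) ''
          {x : E3 | ∀ i, ![-(ε / 2), -(ε / 2), -ε] i ≤ x i ∧ x i ≤ ![1 + ε / 2, 1 + ε / 2, 0] i} := by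
  have hv : g ((2 * h / 3) • intVec ![3, 3, 0]) = (2 * h / 3) • intVec w := by rw [map_smul, hgv]
  rw [← hv]
  obtain ⟨p, T, hdet, hlow, -, hsub⟩ :=
    rdCell_cap_subset_prism hh (show ![1, 1, 0] ∈ fccInt by simp [fccInt]) ε
  exact prism_transport hh g (fun x hx => mem_of_isInvariantUnder hg hx)
    ⟨p, T, hdet, hlow, (trdCell_upCap_subset hh hε).trans hsub⟩

/-- LOWER CLASS: a symmetry of `trdCell h` carrying `(-1,-1,-4)` to `w` yields, for `ε < 1/3`, the
facet prism of the bond `(2h/3)·w` with `|det T| = 4h³` (the half-turn of the `k`-cell's prism at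
`2h(-1,-1,0)`, transported). -/
theorem prism_low_class {h ε : ℝ} (hh : 0 < h) (hε : ε < 1 / 3) {w : Fin 3 → ℤ} (g : E3 ≃ₗᵢ[ℝ] E3)
    (hg : IsInvariantUnder (trdCell h) 0 g.symm) (hgv : g (intVec ![-1, -1, -4]) = intVec w) :
    ∃ (p : E3) (T : E3 →L[ℝ] E3), |T.det| = 4 * h ^ 3 ∧
      (∀ x, Real.sqrt 2 * h * ‖x‖ ≤ ‖T x‖) ∧ Function.Surjective T ∧
      trdCell h ∩ {x | 4 * h ^ 2 * (1 - ε) ≤ inner ℝ x ((2 * h / 3) • intVec w)} ⊆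
        (fun x => p + T x) ''
          {x : E3 | ∀ i, ![-(ε / 2), -(ε / 2), -ε] i ≤ x i ∧ x i ≤ ![1 + ε / 2, 1 + ε / 2, 0] i} := by
  have hv : g ((2 * h / 3) • intVec ![-1, -1, -4]) = (2 * h / 3) • intVec w := by rw [map_smul, hgv]
  rw [← hv]
  obtain ⟨p, T, hdet, hlow, -, hsub⟩ :=
    rdCell_cap_subset_prism hh (show ![-1, -1, 0] ∈ fccInt by simp [fccInt]) ε
  have hH : ∀ u, ‖halfTurn.toLinearIsometry.toContinuousLinearMap u‖ = ‖u‖ :=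
    fun u => halfTurn.norm_map u
  refine prism_transport hh g (fun x hx => mem_of_isInvariantUnder hg hx)
    ⟨halfTurn p, halfTurn.toLinearIsometry.toContinuousLinearMap.comp T, ?_,
      lower_row_comp_of_norm_eq _ T hH hlow,
      (trdCell_lowCap_subset hh hε).trans (image_subset_prism halfTurn hsub)⟩
  rw [abs_det_comp_of_norm_eq_left _ _ hH, hdet]

/-! ## §2 The twelve bonds: coordinate permutations act on `hcpInt` with three orbits -/

/-- The swap of the first two coordinates on integer vectors. -/
theorem swapIso_intVec (w : Fin 3 → ℤ) : swapIso (intVec w) = intVec ![w 1, w 0, w 2] := by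
  ext i
  fin_cases i
  · show swapIso (intVec w) 0 = _; rw [swapIso_apply_zero]; simp
  · show swapIso (intVec w) 1 = _; rw [swapIso_apply_one]; simp
  · show swapIso (intVec w) 2 = _; rw [swapIso_apply_two]; simp

/-- ★ ORBITS: every `w ∈ hcpInt` is the image, under a symmetry of `trdCell h` (a word in `cycIso`,
`swapIso`, with its inverse), of the representative of its class: `(3,-3,0)` (equatorial, `Σw = 0`),
`(3,3,0)` (upper, `Σw = 6`) or `(-1,-1,-4)` (lower, `Σw = -6`). -/
theorem exists_symmetry_of_mem_hcpInt (h : ℝ) {w : Fin 3 → ℤ} (hw : w ∈ hcpInt) :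
    ∃ g : E3 ≃ₗᵢ[ℝ] E3, IsInvariantUnder (trdCell h) 0 g ∧ IsInvariantUnder (trdCell h) 0 g.symm ∧
      ((g (intVec ![3, -3, 0]) = intVec w ∧ w 0 + w 1 + w 2 = 0) ∨
        (g (intVec ![3, 3, 0]) = intVec w ∧ w 0 + w 1 + w 2 = 6) ∨
        (g (intVec ![-1, -1, -4]) = intVec w ∧ w 0 + w 1 + w 2 = -6)) := by
  have iC : IsInvariantUnder (trdCell h) 0 cycIso := trdCell_invariant_cyc h
  have iCs : IsInvariantUnder (trdCell h) 0 cycIso.symm := trdCell_invariant_cyc_symm h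
  have iS : IsInvariantUnder (trdCell h) 0 swapIso := trdCell_invariant_swap h
  have iSs : IsInvariantUnder (trdCell h) 0 swapIso.symm := trdCell_invariant_swap_symm h
  have iI : IsInvariantUnder (trdCell h) 0 (LinearIsometryEquiv.refl ℝ E3) :=
    isInvariantUnder_of_mapsTo fun x hx => hx
  simp only [hcpInt, Finset.mem_insert, Finset.mem_singleton] at hw
  rcases hw with rfl | rfl | rfl | rfl | rfl | rfl | rfl | rfl | rfl | rfl | rfl | rfl
  · exact ⟨_, iI, iI, Or.inl ⟨rfl, by simp⟩⟩
  · refine ⟨swapIso, iS, iSs, Or.inl ⟨?_, by simp⟩⟩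
    rw [swapIso_intVec]; rfl
  · refine ⟨cycIso.trans swapIso, isInvariantUnder_trans iC iS, ?_, Or.inl ⟨?_, by simp⟩⟩
    · rw [LinearIsometryEquiv.symm_trans]; exact isInvariantUnder_trans iSs iCs
    · rw [LinearIsometryEquiv.trans_apply, cycIso_intVec, swapIso_intVec]; rfl
  · refine ⟨cycIso.trans cycIso, isInvariantUnder_trans iC iC, ?_, Or.inl ⟨?_, by simp⟩⟩
    · rw [LinearIsometryEquiv.symm_trans]; exact isInvariantUnder_trans iCs iCs
    · rw [LinearIsometryEquiv.trans_apply, cycIso_intVec, cycIso_intVec]; rfl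
  · refine ⟨cycIso, iC, iCs, Or.inl ⟨?_, by simp⟩⟩
    rw [cycIso_intVec]; rfl
  · refine ⟨(cycIso.trans cycIso).trans swapIso,
      isInvariantUnder_trans (isInvariantUnder_trans iC iC) iS, ?_, Or.inl ⟨?_, by simp⟩⟩
    · rw [LinearIsometryEquiv.symm_trans, LinearIsometryEquiv.symm_trans]
      exact isInvariantUnder_trans iSs (isInvariantUnder_trans iCs iCs)
    · rw [LinearIsometryEquiv.trans_apply, LinearIsometryEquiv.trans_apply, cycIso_intVec,
        cycIso_intVec, swapIso_intVec]; rfl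
  · exact ⟨_, iI, iI, Or.inr (Or.inl ⟨rfl, by simp⟩)⟩
  · refine ⟨cycIso.trans cycIso, isInvariantUnder_trans iC iC, ?_, Or.inr (Or.inl ⟨?_, by simp⟩)⟩
    · rw [LinearIsometryEquiv.symm_trans]; exact isInvariantUnder_trans iCs iCs
    · rw [LinearIsometryEquiv.trans_apply, cycIso_intVec, cycIso_intVec]; rfl
  · refine ⟨cycIso, iC, iCs, Or.inr (Or.inl ⟨?_, by simp⟩)⟩
    rw [cycIso_intVec]; rfl
  · exact ⟨_, iI, iI, Or.inr (Or.inr ⟨rfl, by simp⟩)⟩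
  · refine ⟨cycIso.trans cycIso, isInvariantUnder_trans iC iC, ?_, Or.inr (Or.inr ⟨?_, by simp⟩)⟩
    · rw [LinearIsometryEquiv.symm_trans]; exact isInvariantUnder_trans iCs iCs
    · rw [LinearIsometryEquiv.trans_apply, cycIso_intVec, cycIso_intVec]; rfl
  · refine ⟨cycIso, iC, iCs, Or.inr (Or.inr ⟨?_, by simp⟩)⟩
    rw [cycIso_intVec]; rfl

/-- ★★ «CellFacetsHCP»: for `0 < h`, `w ∈ hcpInt` (bond `v = (2h/3)·w`, `‖v‖² = 8h²`, facet plane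
`⟪x, v⟫ = 4h²`) and `ε < 1/3` there are an apex `p` and a frame `T`, onto, with lower row `√2·h` and
`|det T| = 16h³/3` (equatorial bond, `Σw = 0`: trapezoid in its edge parallelogram) resp. `4h³`
(polar bond: rhombus), such that
`trdCell h ∩ {x | 4h²(1 - ε) ≤ ⟪x, v⟫} ⊆ p + T '' ([-ε/2, 1 + ε/2]² × [-ε, 0])`. -/
theorem trdCell_cap_subset_prism {h ε : ℝ} (hh : 0 < h) (hε : ε < 1 / 3) {w : Fin 3 → ℤ}
    (hw : w ∈ hcpInt) :
    ∃ (p : E3) (T : E3 →L[ℝ] E3),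
      |T.det| = (if w 0 + w 1 + w 2 = 0 then 16 / 3 * h ^ 3 else 4 * h ^ 3) ∧
      (∀ x, Real.sqrt 2 * h * ‖x‖ ≤ ‖T x‖) ∧ Function.Surjective T ∧
      trdCell h ∩ {x | 4 * h ^ 2 * (1 - ε) ≤ inner ℝ x ((2 * h / 3) • intVec w)} ⊆
        (fun x => p + T x) ''
          {x : E3 | ∀ i, ![-(ε / 2), -(ε / 2), -ε] i ≤ x i ∧ x i ≤ ![1 + ε / 2, 1 + ε / 2, 0] i} := by
  obtain ⟨g, -, hg', hcls⟩ := exists_symmetry_of_mem_hcpInt h hw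
  rcases hcls with ⟨hgv, hs⟩ | ⟨hgv, hs⟩ | ⟨hgv, hs⟩
  · rw [if_pos hs]; exact prism_eq_class hh ε g hg' hgv
  · rw [if_neg (by rw [hs]; norm_num)]; exact prism_up_class hh hε g hg' hgv
  · rw [if_neg (by rw [hs]; norm_num)]; exact prism_low_class hh hε g hg' hgv

/-- The total Jacobian over the twelve bonds of the `h`-cell: `6·(16h³/3) + 6·4h³ = 56h³`
(`= (7/6)·48h³`, the `k`-cell's twelve rhombi giving `48h³`). -/
theorem sum_det_hcp (h : ℝ) :
    ∑ w ∈ hcpInt, (if w 0 + w 1 + w 2 = 0 then 16 / 3 * h ^ 3 else 4 * h ^ 3) = 56 * h ^ 3 := by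
  rw [hcpInt]
  repeat rw [Finset.sum_insert (by decide)]
  rw [Finset.sum_singleton]
  simp only [Matrix.cons_val_zero, Matrix.cons_val_one, Matrix.cons_val_two, Matrix.head_cons,
    Matrix.tail_cons]
  norm_num
  ring

/-! ## §3 The facet half-spaces (hypothesis `hK'` of «CollarKit») -/

/-- The squared length of an fcc bond `2h·w`, `w ∈ fccInt`: `8h²`. -/
theorem norm_sq_fccBond (h : ℝ) {w : Fin 3 → ℤ} (hw : w ∈ fccInt) : ‖(2 * h) • intVec w‖ ^ 2 = 8 * h ^ 2 := by
  rw [← real_inner_self_eq_norm_sq, inner_two_h_intVec]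
  simp only [PiLp.smul_apply, smul_eq_mul, intVec_apply]
  simp only [fccInt, Finset.mem_insert, Finset.mem_singleton] at hw
  rcases hw with rfl | rfl | rfl | rfl | rfl | rfl | rfl | rfl | rfl | rfl | rfl | rfl <;>
    simp <;> ring

/-- The squared length of an hcp bond `(2h/3)·w`, `w ∈ hcpInt`: `8h²`. -/
theorem norm_sq_hcpBond (h : ℝ) {w : Fin 3 → ℤ} (hw : w ∈ hcpInt) :
    ‖(2 * h / 3) • intVec w‖ ^ 2 = 8 * h ^ 2 := by
  rw [← real_inner_self_eq_norm_sq, inner_smul_intVec_fin3]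
  simp only [PiLp.smul_apply, smul_eq_mul, intVec_apply]
  simp only [hcpInt, Finset.mem_insert, Finset.mem_singleton] at hw
  rcases hw with rfl | rfl | rfl | rfl | rfl | rfl | rfl | rfl | rfl | rfl | rfl | rfl <;>
    simp <;> ring

/-- ★ FACET HALF-SPACES of the `k`-cell: `⟪x, u⟫ ≤ 4h² = ‖u‖²/2` for every own bond `u = 2h·w`,
`w ∈ fccInt`, and every `x ∈ rdCell h`. -/
theorem inner_bond_le_of_mem_rdCell {h : ℝ} {x : E3} (hx : x ∈ rdCell h) {w : Fin 3 → ℤ}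
    (hw : w ∈ fccInt) : inner ℝ x ((2 * h) • intVec w) ≤ 4 * h ^ 2 := by
  obtain ⟨h01, h02, h12⟩ := mem_rdCell_iff.1 hx
  have a0 := le_abs_self (x 0); have b0 := neg_abs_le (x 0)
  have a1 := le_abs_self (x 1); have b1 := neg_abs_le (x 1)
  have a2 := le_abs_self (x 2); have b2 := neg_abs_le (x 2)
  have h0 : 0 ≤ h := by linarith [abs_nonneg (x 0), abs_nonneg (x 1)]
  rw [inner_two_h_intVec]
  have key : ∀ L : ℝ, L ≤ 2 * h → 2 * h * L ≤ 4 * h ^ 2 := fun L hL => by nlinarith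
  apply key
  simp only [fccInt, Finset.mem_insert, Finset.mem_singleton] at hw
  rcases hw with rfl | rfl | rfl | rfl | rfl | rfl | rfl | rfl | rfl | rfl | rfl | rfl <;>
    simp <;> linarith

/-- ★ FACET HALF-SPACES of the `h`-cell: `⟪x, u⟫ ≤ 4h² = ‖u‖²/2` for every own bond `u = (2h/3)·w`,
`w ∈ hcpInt`, and every `x ∈ trdCell h` (on the lower half through `halfTurn x ∈ rdCell h`). -/
theorem inner_bond_le_of_mem_trdCell {h : ℝ} {x : E3} (hx : x ∈ trdCell h) {w : Fin 3 → ℤ}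
    (hw : w ∈ hcpInt) : inner ℝ x ((2 * h / 3) • intVec w) ≤ 4 * h ^ 2 := by
  rw [inner_smul_intVec_fin3]
  have key : ∀ L : ℝ, 0 ≤ h → L ≤ 6 * h → 2 * h / 3 * L ≤ 4 * h ^ 2 := fun L h0 hL => by nlinarith
  simp only [hcpInt, Finset.mem_insert, Finset.mem_singleton] at hw
  rcases mem_trdCell_cases hx with ⟨hrd, hS⟩ | ⟨hrd, hS⟩
  · obtain ⟨h01, h02, h12⟩ := mem_rdCell_iff.1 hrd
    have a0 := le_abs_self (x 0); have b0 := neg_abs_le (x 0)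
    have a1 := le_abs_self (x 1); have b1 := neg_abs_le (x 1)
    have a2 := le_abs_self (x 2); have b2 := neg_abs_le (x 2)
    have h0 : 0 ≤ h := by linarith [abs_nonneg (x 0), abs_nonneg (x 1)]
    apply key _ h0
    rcases hw with rfl | rfl | rfl | rfl | rfl | rfl | rfl | rfl | rfl | rfl | rfl | rfl <;>
      simp <;> linarith
  · obtain ⟨h01, h02, h12⟩ := mem_rdCell_iff.1 hrd
    have e0 := halfTurn_apply x 0
    have e1 := halfTurn_apply x 1
    have e2 := halfTurn_apply x 2
    have a0 := le_abs_self (halfTurn x 0); have b0 := neg_abs_le (halfTurn x 0)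
    have a1 := le_abs_self (halfTurn x 1); have b1 := neg_abs_le (halfTurn x 1)
    have a2 := le_abs_self (halfTurn x 2); have b2 := neg_abs_le (halfTurn x 2)
    have h0 : 0 ≤ h := by linarith [abs_nonneg (halfTurn x 0), abs_nonneg (halfTurn x 1)]
    apply key _ h0
    rcases hw with rfl | rfl | rfl | rfl | rfl | rfl | rfl | rfl | rfl | rfl | rfl | rfl <;>
      simp <;> linarith

/-- The packaged hypothesis `hK'` of «CollarKit» `inter_subset_image_cap` for a `k`-neighbour seen
across its own bond `u = 2h·w` (`v = -u` points from the site to the neighbour):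
`rdCell h ⊆ {x | -(‖v‖²/2) ≤ ⟪x, v⟫}`. -/
theorem rdCell_subset_halfspace {h : ℝ} {w : Fin 3 → ℤ} (hw : w ∈ fccInt) :
    rdCell h ⊆ {x | -(‖-((2 * h) • intVec w)‖ ^ 2 / 2) ≤ inner ℝ x (-((2 * h) • intVec w))} := by
  intro x hx
  rw [mem_setOf_eq, norm_neg, norm_sq_fccBond h hw, inner_neg_right]
  have := inner_bond_le_of_mem_rdCell hx hw
  linarith

/-- The same for an `h`-neighbour across its own bond `u = (2h/3)·w`, `w ∈ hcpInt`. -/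
theorem trdCell_subset_halfspace {h : ℝ} {w : Fin 3 → ℤ} (hw : w ∈ hcpInt) :
    trdCell h ⊆
      {x | -(‖-((2 * h / 3) • intVec w)‖ ^ 2 / 2) ≤ inner ℝ x (-((2 * h / 3) • intVec w))} := by
  intro x hx
  rw [mem_setOf_eq, norm_neg, norm_sq_hcpBond h hw, inner_neg_right]
  have := inner_bond_le_of_mem_trdCell hx hw
  linarith

end

end Summit.AtomisticToContinuum.Crystallization.Theorems.OverbindingBudgetAffineFarFieldCellFacetsHCP
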